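import Summits.QuantumFields.YangMills.Theorems.SoloInformedNonFreezingFloor
import HarnessLib
import HarnessLib.Audit.Tags

/-!
# QuantumFields / YangMills — non-freezing from a tree-level LIMIT (solo seat `solo-QuantumFields-informed`)

Third kernel file of the non-freezing rung.  `SoloInformedNonFreezingFloor.lean` reduced `LatticeNonFreezing`
to a one-sided FLOOR (`SmearedFloorWitness`: some finite weighted sum of plaquette pair correlations at
polynomial separation exceeds `c β^{−p} ∑|W|`).  Session 8 of the seat observed that its analytic argument
(paper/nonfreezing.md v2.3, Theorem A′) is two-sided: every error term is bounded in absolute value, so the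
same proof plan yields an ASYMPTOTIC — `β² · ⟨θA_ℓ · A_ℓ⟩_{β,S} → q` with `q > 0` the lowest-order (tree-level,
order `g⁴ = β^{−2}`) lattice perturbation-theory coefficient of the smeared plaquette–plaquette covariance,
uniformly in the volume and at smearing/separation scales `ℓ ≤ β^ε`; this is the lowest-order case, for one
family of connected correlations, of volume-uniform asymptoticity of weak-coupling perturbation theory.

This file records the limit form as a node and the (elementary) fact that a limit with `q > 0` and a
power-law rate is a floor:
* `TreeLevelLimitWitness` — the node: weights `W` with `∑|W| ≤ β^m`, displacements with `β ≤ n^k`, and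
  `|β² · ∑ W·⟨P₀ ; P_{(n,y)}⟩ − q| ≤ C β^{−σ}` with `q, σ > 0` [conjecture: the seat's analytic target, v2.3];
* `smearedFloorWitness_of_treeLevelLimit : TreeLevelLimitWitness → SmearedFloorWitness`
  (`p = m + 2`, `c = q/4`, for `β` so large that `C β^{−σ} < q/2`);
* `latticeNonFreezing_of_treeLevelLimit : TreeLevelLimitWitness → LatticeNonFreezing` (composition with
  `latticeNonFreezing_of_smearedFloor`).

Informal companion: the seat's `paper/nonfreezing.md` v2.3, §0.2 (Theorem A′) and §2 "Assembly, two-sided".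
-/

open MeasureTheory Filter Topology
open Literature.MathematicalPhysics.AQFT Literature.MathematicalPhysics.QuantumLattice
open Literature.MathematicalPhysics.QuantumFieldTheory Literature.Probability.LatticeModels

noncomputable section

namespace Summit.QuantumFields.YangMills.Theorems

/-! ### The tree-level limit node -/

/-- **Tree-level limit witness.** Per compact simple `G` and representation `r`: there are `k m : ℕ`, a limit
`q > 0`, a rate `σ > 0` and a constant `C` such that for all large `β`, on EVERY large torus of side `2S+1`,
there are finitely many displacements `(n, y)` — all with `β ≤ n^k`, `n ≤ S`, `y` spatial — and real weights
`W` with `∑|W| ≤ β^m` (intended: `W(n,y) = ∑ₓ θh_ℓ(x) h_ℓ(x + (n,y))`, `‖h_ℓ‖₁² ≤ β^m`, `ℓ = ⌈β^ε⌉`) such that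
`|β² · ∑ W(n,y) ⟨P₀ ; P_{(n,y)}⟩_{β,S} − q| ≤ C β^{−σ}` (intended: `q = Q₂^{cont}(η_d) > 0`, the tree-level
coefficient; paper/nonfreezing.md v2.3 Theorem A′ with 7.3). [conjecture: the seat's analytic target, limit
form; strictly stronger than `SmearedFloorWitness`] -/
@[conjecture] def TreeLevelLimitWitness : Prop :=
  ∀ (G : Type) [Group G] [TopologicalSpace G] [IsTopologicalGroup G] [CompactSpace G],
    IsCompactSimpleLieGroup G →
      letI : MeasurableSpace G := borel G
      haveI : BorelSpace G := ⟨rfl⟩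
      ∀ (r : LatticeRep G), ∃ (k m : ℕ) (q σ C : ℝ), 0 < q ∧ 0 < σ ∧
        ∃ β₁ : ℝ, ∀ β : ℝ, β₁ ≤ β → ∃ S₁ : ℕ, ∀ S : ℕ, S₁ ≤ S →
          ∃ (s : Finset (ℕ × Site 4)) (W : ℕ × Site 4 → ℝ),
            (∀ d ∈ s, β ≤ (d.1 : ℝ) ^ k ∧ d.1 ≤ S ∧ d.2 0 = 0) ∧
            (∑ d ∈ s, |W d|) ≤ β ^ m ∧
            |β ^ 2 * (∑ d ∈ s, W d * latticeConnectedCorr r.ρ β (2 * S + 1) r.curvature.F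
                (fun U => r.curvature.F (configShift (-d.2) U)) d.1) - q| ≤ C * β ^ (-σ)

/-! ### A positive limit with a rate is a floor -/

/-- Elementary step: if `|β² X − q| ≤ e` with `e < q/2`, `0 < β`, and `w ≤ β^m`, `0 < q`, then
`(q/4) · (β^(m+2))⁻¹ · w < |X|`. -/
theorem floor_of_limit_step {β X q e w : ℝ} {m : ℕ} (hβ : 0 < β) (hq : 0 < q)
    (hX : |β ^ 2 * X - q| ≤ e) (he : e < q / 2) (hw : w ≤ β ^ m) :
    q / 4 * (β ^ (m + 2))⁻¹ * w < |X| := by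
  have hβ2 : 0 < β ^ 2 := pow_pos hβ 2
  have hβm : 0 < β ^ m := pow_pos hβ m
  have hβm2 : 0 < β ^ (m + 2) := pow_pos hβ (m + 2)
  -- lower bound on β² |X|
  have h1 : q / 2 < β ^ 2 * |X| := by
    have : q - e ≤ β ^ 2 * X := by
      have := (abs_le.mp hX).1
      linarith
    have h2 : q / 2 < β ^ 2 * X := by linarith
    calc q / 2 < β ^ 2 * X := h2
      _ ≤ |β ^ 2 * X| := le_abs_self _
      _ = β ^ 2 * |X| := by rw [abs_mul, abs_of_pos hβ2]
  -- upper bound on the left-hand side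
  have h3 : q / 4 * (β ^ (m + 2))⁻¹ * w ≤ q / 4 * (β ^ 2)⁻¹ := by
    have hw' : (β ^ (m + 2))⁻¹ * w ≤ (β ^ (m + 2))⁻¹ * β ^ m :=
      mul_le_mul_of_nonneg_left hw (inv_nonneg.mpr hβm2.le)
    have heq : (β ^ (m + 2))⁻¹ * β ^ m = (β ^ 2)⁻¹ := by
      rw [pow_add, mul_inv, mul_comm (β ^ m)⁻¹, mul_assoc, inv_mul_cancel₀ hβm.ne', mul_one]
    calc q / 4 * (β ^ (m + 2))⁻¹ * w = q / 4 * ((β ^ (m + 2))⁻¹ * w) := by ring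
      _ ≤ q / 4 * ((β ^ (m + 2))⁻¹ * β ^ m) :=
          mul_le_mul_of_nonneg_left hw' (by positivity)
      _ = q / 4 * (β ^ 2)⁻¹ := by rw [heq]
  have h4 : q / 4 * (β ^ 2)⁻¹ < |X| := by
    rw [← div_eq_mul_inv, div_lt_iff₀ hβ2]
    calc q / 4 < q / 2 := by linarith
      _ < β ^ 2 * |X| := h1
      _ = |X| * β ^ 2 := mul_comm _ _
  exact lt_of_le_of_lt h3 h4

/-- **Limit ⇒ floor.** A tree-level limit witness is a smeared floor witness (`p = m + 2`, `c = q/4`). -/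
theorem smearedFloorWitness_of_treeLevelLimit (hT : TreeLevelLimitWitness) : SmearedFloorWitness := by
  intro G _ _ _ _ hG
  letI : MeasurableSpace G := borel G
  haveI : BorelSpace G := ⟨rfl⟩
  intro r
  obtain ⟨k, m, q, σ, C, hq, hσ, β₁, hβ₁⟩ := hT G hG r
  -- C β^{−σ} → 0, so eventually C β^{−σ} < q/2
  have hlim : Tendsto (fun β : ℝ => C * β ^ (-σ)) atTop (𝓝 0) := by
    have h := (tendsto_rpow_neg_atTop hσ).const_mul C
    simpa using h
  have hev : ∀ᶠ β : ℝ in atTop, C * β ^ (-σ) < q / 2 :=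
    hlim.eventually_lt_const (by linarith)
  obtain ⟨B, hB⟩ := Filter.eventually_atTop.mp hev
  refine ⟨k, m + 2, q / 4, by linarith, max β₁ (max 1 B), fun β hβ => ?_⟩
  have hβ₁' : β₁ ≤ β := le_trans (le_max_left _ _) hβ
  have hβ1 : 1 ≤ β := le_trans (le_trans (le_max_left _ _) (le_max_right _ _)) hβ
  have hβB : B ≤ β := le_trans (le_trans (le_max_right _ _) (le_max_right _ _)) hβ
  have hβpos : 0 < β := lt_of_lt_of_le one_pos hβ1
  obtain ⟨S₁, hS₁⟩ := hβ₁ β hβ₁'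
  refine ⟨S₁, fun S hS => ?_⟩
  obtain ⟨s, W, hsW, hsum, hlimit⟩ := hS₁ S hS
  refine ⟨s, W, hsW, ?_⟩
  exact floor_of_limit_step hβpos hq hlimit (hB β hβB) hsum

/-- **Non-freezing from the tree-level limit** (composition with `latticeNonFreezing_of_smearedFloor`). -/
theorem latticeNonFreezing_of_treeLevelLimit (hT : TreeLevelLimitWitness) : LatticeNonFreezing :=
  latticeNonFreezing_of_smearedFloor (smearedFloorWitness_of_treeLevelLimit hT)

/-- The criterion as a named implication. -/
def NonFreezingLimitCriterion : Prop := TreeLevelLimitWitness → LatticeNonFreezing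

/-- `NonFreezingLimitCriterion` holds. -/
theorem NonFreezingLimitCriterion_holds : NonFreezingLimitCriterion := latticeNonFreezing_of_treeLevelLimit

end Summit.QuantumFields.YangMills.Theorems

end
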